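import Literature.Topology.PlanarFoliations.Kneser
import HarnessLib

/-!
# The two sides of a compact leaf along a vertical

Sibling of `Kneser.lean` (`mul_pos_of_isCrossing`). For a compact leaf `K` of a bi-oriented
foliation of a plane domain `X ↪ ℂ` and a flow box `e` at a point `k ∈ K`, the points
`e⁻¹(u₀, a)` and `e⁻¹(u₀, b)` of the vertical through `k = e⁻¹(u₀, s)` with `a < s < b` lie in
**different complementary domains** of `ι(K)`: they are off `K` (a compact leaf crosses a
vertical only once, `compactLeaf_vert_subsingleton`), not both inner and not both outer — if both
were inner (resp. outer), sweeping the two punctured vertical halves along the plaques would make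
a whole box around `k` minus the plaque of `k` inner (resp. outer), but `k` is in the closure of
the outer (resp. inner) domain. This is the local form of the Jordan curve theorem along a
transversal, used to locate the centre of the coned fence collar inside its essential compact
leaf.

* `vert_not_mem_leaf`, `not_both_insideLeaf`, `not_both_outsideLeaf`,
  `mem_insideLeaf_iff_mem_outsideLeaf` (**proved**).

All statements are [folklore].
-/

noncomputable section

open Set Filter Function Bornology
open _root_.Topology
open Literature.Topology.FourManifolds Literature.Topology.FourManifolds.Foliation

namespace Literature.Topology.PlanarFoliations

variable {X : Type*} [TopologicalSpace X] [T2Space X] [SecondCountableTopology X] {F : Foliation ℝ X}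
variable {e : OpenPartialHomeomorph X (ℝ × ℝ)} {ι : X → ℂ}

/-- Off the height of `k`, the vertical through `k` avoids the compact leaf of `k`. [folklore] -/
theorem vert_not_mem_leaf (hbi : IsBiOriented F) (hι : IsOpenEmbedding ι) {y : X} (hK : IsCompact (F.leaf y)) (he : e ∈ F.atlas)
    {k : X} (hk : k ∈ F.leaf y) (hke : k ∈ e.source) {t : ℝ} (ht : t ≠ (e k).2) : e.symm ((e k).1, t) ∉ F.leaf y := by
  haveI : Nontrivial X := nontrivial_of_foliation F y
  intro h
  have hkeq : e.symm ((e k).1, (e k).2) = k := by rw [show ((e k).1, (e k).2) = e k from rfl, e.left_inv hke]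
  exact ht (compactLeaf_vert_subsingleton hbi hι hK he h (by rw [hkeq]; exact hk))

/-- **Two points of the vertical through `k ∈ K` on opposite sides of `k` are not both inner.**
[folklore] -/
theorem not_both_insideLeaf (hbi : IsBiOriented F) (hι : IsOpenEmbedding ι) {y : X} (hK : IsCompact (F.leaf y)) (he : e ∈ F.atlas)
    {k : X} (hk : k ∈ F.leaf y) (hke : k ∈ e.source) {a b : ℝ} (has : a < (e k).2) (hsb : (e k).2 < b)
    (hain : ι (e.symm ((e k).1, a)) ∈ insideLeaf F ι y) (hbin : ι (e.symm ((e k).1, b)) ∈ insideLeaf F ι y) : False := by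
  haveI : Nontrivial X := nontrivial_of_foliation F y
  set u₀ := (e k).1 with hu₀
  set s := (e k).2 with hs
  have hkeq : e.symm (u₀, s) = k := by rw [show (u₀, s) = e k from rfl, e.left_inv hke]
  have hKk : F.leaf k = F.leaf y := leaf_eq_of_mem hk
  have hvertK : ∀ {t : ℝ}, e.symm (u₀, t) ∈ F.leaf y → t = s := fun {t} ht' ↦
    compactLeaf_vert_subsingleton hbi hι hK he ht' (by rw [hkeq]; exact hk)
  have hplaqueK : ∀ {t u : ℝ}, e.symm (u, t) ∈ F.leaf y → t = s := fun {t u} h ↦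
    hvertK (F.plaque_subset_leaf_of_mem he h (F.symm_mem_plaque he u t) (F.symm_mem_plaque he u₀ t))
  -- a connected set of points `e⁻¹(q)` off `K` containing an inner point is inner
  have hsweep : ∀ {S : Set (ℝ × ℝ)}, IsPreconnected S → (∀ q ∈ S, e.symm q ∉ F.leaf y) →
      (∃ q ∈ S, ι (e.symm q) ∈ insideLeaf F ι y) → ∀ q ∈ S, ι (e.symm q) ∈ insideLeaf F ι y := by
    intro S hS hSK ⟨q₀, hq₀, hq₀in⟩ q hq
    have hsub := subset_insideLeaf_of_isPreconnected hbi hι hK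
      (hS.image _ (isOpenEmbedding_symm he hι).continuous.continuousOn)
      (disjoint_left.2 (by rintro _ ⟨q', hq', rfl⟩ h; exact hSK q' hq' ((hι.injective.mem_set_image).1 h)))
      ⟨_, mem_image_of_mem _ hq₀, hq₀in⟩
    exact hsub (mem_image_of_mem _ hq)
  -- the two punctured vertical halves are inner
  have hlow : ∀ t ∈ Ico a s, ι (e.symm (u₀, t)) ∈ insideLeaf F ι y := fun t ht' ↦
    hsweep ((isPreconnected_Ico (a := a) (b := s)).image _ (continuous_const.prodMk continuous_id).continuousOn)
      (by rintro _ ⟨τ, hτ, rfl⟩ h; exact absurd (hvertK h) (ne_of_lt hτ.2))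
      ⟨(u₀, a), ⟨a, ⟨le_rfl, has⟩, rfl⟩, hain⟩ (u₀, t) ⟨t, ht', rfl⟩
  have hhigh : ∀ t ∈ Ioc s b, ι (e.symm (u₀, t)) ∈ insideLeaf F ι y := fun t ht' ↦
    hsweep ((isPreconnected_Ioc (a := s) (b := b)).image _ (continuous_const.prodMk continuous_id).continuousOn)
      (by rintro _ ⟨τ, hτ, rfl⟩ h; exact absurd (hvertK h) (ne_of_gt hτ.1))
      ⟨(u₀, b), ⟨b, ⟨hsb, le_rfl⟩, rfl⟩, hbin⟩ (u₀, t) ⟨t, ht', rfl⟩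
  -- hence the box `ℝ × (a, b)` minus the plaque of `k` is inner
  have hbox : ∀ q : ℝ × ℝ, q.2 ∈ Ioo a b → q.2 ≠ s → ι (e.symm q) ∈ insideLeaf F ι y := by
    rintro ⟨u, t⟩ ht' hts
    have hrow : ∀ u', ι (e.symm (u', t)) ∈ insideLeaf F ι y → ι (e.symm (u, t)) ∈ insideLeaf F ι y := fun u' hu' ↦
      hsweep ((isPreconnected_univ (α := ℝ)).image _ (continuous_id.prodMk continuous_const).continuousOn)
        (by rintro _ ⟨v, -, rfl⟩ h; exact hts (hplaqueK h)) ⟨(u', t), ⟨u', mem_univ _, rfl⟩, hu'⟩ (u, t) ⟨u, mem_univ _, rfl⟩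
    rcases lt_or_gt_of_ne hts with h | h
    · exact hrow u₀ (hlow t ⟨ht'.1.le, h⟩)
    · exact hrow u₀ (hhigh t ⟨h, ht'.2.le⟩)
  -- but `k` is in the closure of the outer domain
  have hkcl : ι k ∈ closure (outsideLeaf F ι y) := image_mem_closure_outsideLeaf hbi hι hK hk
  set N : Set ℂ := (fun q : ℝ × ℝ ↦ ι (e.symm q)) '' (univ ×ˢ Ioo a b) with hN
  have hNo : IsOpen N := (isOpenEmbedding_symm he hι).isOpenMap _ (isOpen_univ.prod isOpen_Ioo)
  have hkN : ι k ∈ N := ⟨(u₀, s), ⟨mem_univ _, has, hsb⟩, by show ι (e.symm (u₀, s)) = ι k; rw [hkeq]⟩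
  obtain ⟨z, hzN, hzout⟩ := mem_closure_iff.1 hkcl N hNo hkN
  obtain ⟨q, ⟨-, hq⟩, rfl⟩ := hzN
  by_cases hqs : q.2 = s
  · refine hzout.1 (mem_image_of_mem ι ?_)
    have hq' : e.symm q ∈ plaque e s := by rw [show q = (q.1, s) from Prod.ext rfl hqs]; exact F.symm_mem_plaque he q.1 s
    rw [← hKk]
    exact F.plaque_subset_leaf_of_mem he (F.mem_leaf_self k) (by rw [← hkeq]; exact F.symm_mem_plaque he u₀ s) hq'
  · exact disjoint_left.1 (disjoint_insideLeaf_outsideLeaf y) (hbox q hq hqs) hzout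

/-- **Two points of the vertical through `k ∈ K` on opposite sides of `k` are not both outer.**
[folklore] -/
theorem not_both_outsideLeaf (hbi : IsBiOriented F) (hι : IsOpenEmbedding ι) {y : X} (hK : IsCompact (F.leaf y)) (he : e ∈ F.atlas)
    {k : X} (hk : k ∈ F.leaf y) (hke : k ∈ e.source) {a b : ℝ} (has : a < (e k).2) (hsb : (e k).2 < b)
    (haout : ι (e.symm ((e k).1, a)) ∈ outsideLeaf F ι y) (hbout : ι (e.symm ((e k).1, b)) ∈ outsideLeaf F ι y) : False := by
  haveI : Nontrivial X := nontrivial_of_foliation F y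
  set u₀ := (e k).1 with hu₀
  set s := (e k).2 with hs
  have hkeq : e.symm (u₀, s) = k := by rw [show (u₀, s) = e k from rfl, e.left_inv hke]
  have hKk : F.leaf k = F.leaf y := leaf_eq_of_mem hk
  have hvertK : ∀ {t : ℝ}, e.symm (u₀, t) ∈ F.leaf y → t = s := fun {t} ht' ↦
    compactLeaf_vert_subsingleton hbi hι hK he ht' (by rw [hkeq]; exact hk)
  have hplaqueK : ∀ {t u : ℝ}, e.symm (u, t) ∈ F.leaf y → t = s := fun {t u} h ↦
    hvertK (F.plaque_subset_leaf_of_mem he h (F.symm_mem_plaque he u t) (F.symm_mem_plaque he u₀ t))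
  have hsweep : ∀ {S : Set (ℝ × ℝ)}, IsPreconnected S → (∀ q ∈ S, e.symm q ∉ F.leaf y) →
      (∃ q ∈ S, ι (e.symm q) ∈ outsideLeaf F ι y) → ∀ q ∈ S, ι (e.symm q) ∈ outsideLeaf F ι y := by
    intro S hS hSK ⟨q₀, hq₀, hq₀in⟩ q hq
    have hsub := subset_outsideLeaf_of_isPreconnected hbi hι hK
      (hS.image _ (isOpenEmbedding_symm he hι).continuous.continuousOn)
      (disjoint_left.2 (by rintro _ ⟨q', hq', rfl⟩ h; exact hSK q' hq' ((hι.injective.mem_set_image).1 h)))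
      ⟨_, mem_image_of_mem _ hq₀, hq₀in⟩
    exact hsub (mem_image_of_mem _ hq)
  have hlow : ∀ t ∈ Ico a s, ι (e.symm (u₀, t)) ∈ outsideLeaf F ι y := fun t ht' ↦
    hsweep ((isPreconnected_Ico (a := a) (b := s)).image _ (continuous_const.prodMk continuous_id).continuousOn)
      (by rintro _ ⟨τ, hτ, rfl⟩ h; exact absurd (hvertK h) (ne_of_lt hτ.2))
      ⟨(u₀, a), ⟨a, ⟨le_rfl, has⟩, rfl⟩, haout⟩ (u₀, t) ⟨t, ht', rfl⟩
  have hhigh : ∀ t ∈ Ioc s b, ι (e.symm (u₀, t)) ∈ outsideLeaf F ι y := fun t ht' ↦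
    hsweep ((isPreconnected_Ioc (a := s) (b := b)).image _ (continuous_const.prodMk continuous_id).continuousOn)
      (by rintro _ ⟨τ, hτ, rfl⟩ h; exact absurd (hvertK h) (ne_of_gt hτ.1))
      ⟨(u₀, b), ⟨b, ⟨hsb, le_rfl⟩, rfl⟩, hbout⟩ (u₀, t) ⟨t, ht', rfl⟩
  have hbox : ∀ q : ℝ × ℝ, q.2 ∈ Ioo a b → q.2 ≠ s → ι (e.symm q) ∈ outsideLeaf F ι y := by
    rintro ⟨u, t⟩ ht' hts
    have hrow : ∀ u', ι (e.symm (u', t)) ∈ outsideLeaf F ι y → ι (e.symm (u, t)) ∈ outsideLeaf F ι y := fun u' hu' ↦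
      hsweep ((isPreconnected_univ (α := ℝ)).image _ (continuous_id.prodMk continuous_const).continuousOn)
        (by rintro _ ⟨v, -, rfl⟩ h; exact hts (hplaqueK h)) ⟨(u', t), ⟨u', mem_univ _, rfl⟩, hu'⟩ (u, t) ⟨u, mem_univ _, rfl⟩
    rcases lt_or_gt_of_ne hts with h | h
    · exact hrow u₀ (hlow t ⟨ht'.1.le, h⟩)
    · exact hrow u₀ (hhigh t ⟨h, ht'.2.le⟩)
  -- but `k` is in the closure of the inner domain
  have hkcl : ι k ∈ closure (insideLeaf F ι y) := by
    rw [closure_insideLeaf hbi hι hK]; exact image_mem_discLeaf hk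
  set N : Set ℂ := (fun q : ℝ × ℝ ↦ ι (e.symm q)) '' (univ ×ˢ Ioo a b) with hN
  have hNo : IsOpen N := (isOpenEmbedding_symm he hι).isOpenMap _ (isOpen_univ.prod isOpen_Ioo)
  have hkN : ι k ∈ N := ⟨(u₀, s), ⟨mem_univ _, has, hsb⟩, by show ι (e.symm (u₀, s)) = ι k; rw [hkeq]⟩
  obtain ⟨z, hzN, hzin⟩ := mem_closure_iff.1 hkcl N hNo hkN
  obtain ⟨q, ⟨-, hq⟩, rfl⟩ := hzN
  by_cases hqs : q.2 = s
  · refine hzin.1 (mem_image_of_mem ι ?_)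
    have hq' : e.symm q ∈ plaque e s := by rw [show q = (q.1, s) from Prod.ext rfl hqs]; exact F.symm_mem_plaque he q.1 s
    rw [← hKk]
    exact F.plaque_subset_leaf_of_mem he (F.mem_leaf_self k) (by rw [← hkeq]; exact F.symm_mem_plaque he u₀ s) hq'
  · exact disjoint_left.1 (disjoint_insideLeaf_outsideLeaf y) hzin (hbox q hq hqs)

/-- **The two sides of a compact leaf along a vertical**: for `a < s < b` (`s` the height of
`k ∈ K`), `e⁻¹(u₀, a)` is inner iff `e⁻¹(u₀, b)` is outer. [folklore] -/
theorem mem_insideLeaf_iff_mem_outsideLeaf (hbi : IsBiOriented F) (hι : IsOpenEmbedding ι) {y : X} (hK : IsCompact (F.leaf y))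
    (he : e ∈ F.atlas) {k : X} (hk : k ∈ F.leaf y) (hke : k ∈ e.source) {a b : ℝ} (has : a < (e k).2) (hsb : (e k).2 < b) :
    ι (e.symm ((e k).1, a)) ∈ insideLeaf F ι y ↔ ι (e.symm ((e k).1, b)) ∈ outsideLeaf F ι y := by
  have ha : ι (e.symm ((e k).1, a)) ∉ ι '' F.leaf y := fun h ↦
    vert_not_mem_leaf hbi hι hK he hk hke has.ne ((hι.injective.mem_set_image).1 h)
  have hb : ι (e.symm ((e k).1, b)) ∉ ι '' F.leaf y := fun h ↦
    vert_not_mem_leaf hbi hι hK he hk hke hsb.ne' ((hι.injective.mem_set_image).1 h)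
  constructor
  · intro hain
    rcases mem_insideLeaf_or_mem_outsideLeaf hb with hbin | hbout
    · exact (not_both_insideLeaf hbi hι hK he hk hke has hsb hain hbin).elim
    · exact hbout
  · intro hbout
    rcases mem_insideLeaf_or_mem_outsideLeaf ha with hain | haout
    · exact hain
    · exact (not_both_outsideLeaf hbi hι hK he hk hke has hsb haout hbout).elim

end Literature.Topology.PlanarFoliations
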